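/-
Origin: expansion seat `literature-prover-pub-hodgecm-cf-kudla-howe-rallis-g4-0`, handover #3 2026-08-18T07:21:56Z (`HOME/pub-hodgecm-cf-kudla-howe-rallis-g4/MetaplecticUniquenessSmoke.lean`, md5 e26f217f, 144 lines);
landed by the gen-7 packager in gate run 26 as `HodgeCM/Automorphic/MetaplecticUniquenessSmoke.lean` (verbatim).
-/
/-
Origin: HOME/pub-hodgecm-cf-kudla-howe-rallis-g4/MetaplecticUniquenessSmoke.lean — session
literature-prover-pub-hodgecm-cf-kudla-howe-rallis-g4-0 (unit pub-hodgecm-cf-kudla-howe-rallis-g4, CITED-FACT seat (4), gen 4).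
Intended final place: `HodgeCM/Automorphic/MetaplecticUniquenessSmoke.lean` (NEW leaf; imports the LANDED
`HodgeCM.Literature.MetaplecticUniqueness` only; nothing imports it).  NOT for the audited headline list except,
optionally, `nonabelian_smoke_jUnique`.
-/
import Summits.HodgeConjecture.HodgeCM.Literature.MetaplecticUniqueness

set_option autoImplicit false

/-!
# Non-vacuity guard for the S5 uniqueness layer on a NON-ABELIAN PERFECT base

`HodgeCM/Literature/MetaplecticUniqueness.lean` (cf-KHR gen 3, run 24) proves MVW's uniqueness clause for the
homomorphism `j : S̃p(W₁) × S̃p(W₂) → S̃p(W)` ([MVW, Chap. 2, II.1, Rem. (6)]) as the KERNEL theorem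
`MetaplecticSumCovers.jUnique_of_perfect : CentralExtensions → BasePerfect → JUnique`, with `BasePerfect`
(`𝒟(Sp(W_j)(k)) = Sp(W_j)(k)`) the one cited input ([Mar91, I.(2.3.2)(b)] / [Artin, Thm 5.1]).  The existing smoke
`HodgeCM/Automorphic/SeesawDescentSmoke.lean` instantiates the record with `Sp₁ = Sp₂ = Sp = PUnit` (so
`BasePerfect` holds because the trivial group is trivially perfect, and `JUnique` has no content there).

This file is the guard ONE LEVEL UP: the same cited record `MetaplecticSumCovers` instantiated with a NON-ABELIAN
PERFECT base — `Sp₁ = Sp₂ = A₅ = alternatingGroup (Fin 5)` (perfect because SIMPLE and non-abelian, both KERNEL facts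
of Mathlib: `alternatingGroup.isSimpleGroup_five` + two explicit non-commuting even permutations), `Sp = A₅ × A₅`,
central group `A = ℂˣ`, covers `M_j = ℂˣ × A₅`, `M = ℂˣ × (A₅ × A₅)` (split central extensions — genuine central
extensions in the sense of `IsCentralExt`), `j((a,g),(b,h)) = (ab,(g,h))`.  RESULTS (kernel, standard axioms):
`central` (the three sequences are central extensions), `isJ` (`j` lies over `diag` and is `ℂˣ`-equivariant in each
variable), `basePerfect` (from simplicity + non-commutativity — NOT vacuous), hence `jUnique` =
`jUnique_of_perfect` FIRES, and `eq_j` : every homomorphism with the printed properties `IsJ` equals `j`.  So the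
uniqueness theorem that discharges `jt_compat` in `SeesawSplittingDescent.lean` is exercised on a base where
"over the projections and `A`-equivariant" does NOT by itself pin a map down set-theoretically (there are
`|A₅|² · |ℂˣ|`-many set-maps over `diag`), only group-theoretically — exactly the content of MVW's "(unique si F ≠ 𝔽₃)".

Nothing is cited or posited here; no `def … : Prop`; PerL is not touched.  Class K (smoke / non-vacuity).
-/

namespace HodgeCM.Automorphic.ThetaPending.MetaplecticSmokeA5

open HodgeCM.Literature.Theta

/-- The base group: the alternating group `A₅`. -/
abbrev G : Type := alternatingGroup (Fin 5)

/-- Two even permutations of `Fin 5` that do not commute: the 3-cycles `(0 1 2)` and `(2 3 4)`. -/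
def σ : Equiv.Perm (Fin 5) := Equiv.swap 0 1 * Equiv.swap 1 2
/-- see `σ` -/
def τ : Equiv.Perm (Fin 5) := Equiv.swap 2 3 * Equiv.swap 3 4

/-- (Ported verbatim from the HodgeCMPerL package; no docstring in the source.) -/
theorem σ_mem : σ ∈ alternatingGroup (Fin 5) := by
  rw [Equiv.Perm.mem_alternatingGroup, σ, map_mul, Equiv.Perm.sign_swap (by decide),
    Equiv.Perm.sign_swap (by decide)]
  decide

/-- (Ported verbatim from the HodgeCMPerL package; no docstring in the source.) -/
theorem τ_mem : τ ∈ alternatingGroup (Fin 5) := by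
  rw [Equiv.Perm.mem_alternatingGroup, τ, map_mul, Equiv.Perm.sign_swap (by decide),
    Equiv.Perm.sign_swap (by decide)]
  decide

/-- (Ported verbatim from the HodgeCMPerL package; no docstring in the source.) -/
theorem σ_τ_ne : σ * τ ≠ τ * σ := by decide

/-- `A₅` is not commutative (kernel: two explicit non-commuting elements). -/
theorem not_isMulCommutative : ¬ IsMulCommutative G := by
  intro h
  have hc := h.is_comm.comm (⟨σ, σ_mem⟩ : G) ⟨τ, τ_mem⟩
  exact σ_τ_ne (congrArg Subtype.val hc)

/-- **`A₅` is perfect** (kernel): its commutator subgroup is normal, non-trivial (non-abelian), hence everything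
by simplicity (`alternatingGroup.isSimpleGroup_five`). -/
theorem commutator_eq_top : commutator G = ⊤ := by
  rcases (inferInstance : (commutator G).Normal).eq_bot_or_eq_top with h | h
  · exact absurd ((commutator_eq_bot_iff G).mp h) not_isMulCommutative
  · exact h

/-- The covers: split central extensions by `ℂˣ`. -/
abbrev M₁ : Type := ℂˣ × G
/-- see `M₁` -/
abbrev M₂ : Type := ℂˣ × G
/-- see `M₁` -/
abbrev M : Type := ℂˣ × (G × G)

/-- The cited record `MetaplecticSumCovers` ([MVW 2.II.1 (B)], [HKS96 (1.12)]) on the non-abelian base. -/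
abbrev V : MetaplecticSumCovers M₁ M₂ M where
  A := ℂˣ
  Sp₁ := G
  Sp₂ := G
  Sp := G × G
  i₁ := MonoidHom.inl ℂˣ G
  i₂ := MonoidHom.inl ℂˣ G
  i := MonoidHom.inl ℂˣ (G × G)
  p₁ := MonoidHom.snd ℂˣ G
  p₂ := MonoidHom.snd ℂˣ G
  p := MonoidHom.snd ℂˣ (G × G)
  diag := MonoidHom.id (G × G)

/-- A split extension `ℂˣ × H` is a central extension of `H` by `ℂˣ` in the sense of `IsCentralExt`. -/
theorem isCentralExt_inl_snd (H : Type) [Group H] :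
    IsCentralExt (MonoidHom.inl ℂˣ H) (MonoidHom.snd ℂˣ H) := by
  refine ⟨fun a => ?_, fun m hm => ?_, fun h => ⟨(1, h), rfl⟩⟩
  · rw [Subgroup.mem_center_iff]
    intro g
    ext <;> simp [mul_comm]
  · refine ⟨m.1, ?_⟩
    ext
    · simp
    · simp only [MonoidHom.coe_snd] at hm
      simp [hm]

/-- (Ported verbatim from the HodgeCMPerL package; no docstring in the source.) -/
theorem central : V.CentralExtensions :=
  ⟨isCentralExt_inl_snd G, isCentralExt_inl_snd G, isCentralExt_inl_snd (G × G)⟩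

/-- **Not vacuous:** `BasePerfect` for the base `A₅`, `A₅` (kernel, from simplicity). -/
theorem basePerfect : V.BasePerfect :=
  ⟨commutator_eq_top, commutator_eq_top⟩

/-- The `j`-map `((a,g),(b,h)) ↦ (ab,(g,h))`, as a homomorphism: product of the two `ℂˣ`-coordinates (a
homomorphism because `ℂˣ` is commutative) with the pair of base coordinates. -/
def j : M₁ × M₂ →* M :=
  MonoidHom.prod
    (((MonoidHom.fst ℂˣ G).comp (MonoidHom.fst M₁ M₂)) * ((MonoidHom.fst ℂˣ G).comp (MonoidHom.snd M₁ M₂)))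
    ((MonoidHom.snd ℂˣ G).prodMap (MonoidHom.snd ℂˣ G))

/-- (Ported verbatim from the HodgeCMPerL package; no docstring in the source.) -/
theorem j_apply (m₁ : M₁) (m₂ : M₂) : j (m₁, m₂) = (m₁.1 * m₂.1, (m₁.2, m₂.2)) := rfl

/-- `j` has MVW's printed properties: over the projections and `ℂˣ`-equivariant in each variable. -/
theorem isJ : V.IsJ j := by
  refine ⟨fun m₁ m₂ => rfl, fun a m₁ m₂ => ?_, fun a m₁ m₂ => ?_⟩
  · rw [j_apply, j_apply]
    ext <;> simp [mul_assoc]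
  · rw [j_apply, j_apply]
    ext <;> simp [mul_left_comm]

/-- **The cited-layer uniqueness theorem FIRES on the non-abelian model.** -/
theorem jUnique : V.JUnique :=
  MetaplecticSumCovers.jUnique_of_perfect central basePerfect

/-- … and pins every homomorphism with the printed properties to `j`. -/
theorem eq_j (j' : M₁ × M₂ →* M) (h : V.IsJ j') : j' = j :=
  jUnique j' j h isJ

/-- For the audited list (optional): the conjunction actually exercised. -/
theorem nonabelian_smoke_jUnique : V.CentralExtensions ∧ V.BasePerfect ∧ V.JUnique ∧ ¬ IsMulCommutative G :=
  ⟨central, basePerfect, jUnique, not_isMulCommutative⟩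

end HodgeCM.Automorphic.ThetaPending.MetaplecticSmokeA5
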